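import Summits.ABC.IUTFork.Conditional.AbcOfSGenuineKChosenDepthRadRows1
import Summits.ABC.IUTFork.Cor312GenuineKLocalTypeThirty
import HarnessLib

/-!
# Branch C / R-W lane P−: the EXACT-RADIUS («RAD») refutation at abc-TRIPLE data, CERTIFICATE-LIST form — one `decide` per row:
# local type `e ∣ m` from the Tate-exact lemmas, one integer certificate `(e, A, a₀, N)` per divisor of `m`

PROOF-ONLY file (no `def`, no new `Prop`, no instance) of the abc-iut cell (WAVE-5 prover seat abc-iut-w5-d236, gen 9; D-0079 R-W
«WINDOW Θ-SIDE INEQUALITY», CLAIM «W:RAD-GENUINEK lane=P−»; sequel of this seat's `AbcOfSGenuineKChosenDepthRadRatPoint` p464754 /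
`…RadRows1` p466042). TAKES NO SIDE on [IUTchIII] Cor. 3.12 or on any author. It packages the worked Reyssat rows into ONE generic
theorem so that every further kind-RAD / kind-LIN row of HOME/plan/rescue/R-W/TARGETS.tsv at a pole prime `p ∉ {2, 3, 5, l}` is a ten-line
instantiation whose only non-trivial obligations are two `decide`s on literal data:

* §0 `GenuineK.absRamificationIdx_kOf_dvd_two_mul_ratPoint` — the `15 ∣ ord` fibre-point Tate local type (`e ∣ 2·l`; twin of part 1's six/ten);
* §1 `RadTriple.ord_jInv_eq_of_pow_dvd` — for an abc triple and an odd prime `p` with `p^v ∣ abc`, `p^{v+1} ∤ abc`: `ord_p j(a/c) = −2v`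
  EXACTLY (abc-iut-W-neg-1's `Cor22.ord_jInv_ratPoint_triple_eq` + `Nat.Prime.pow_dvd_iff_le_factorization`);
  `GenuineK.absRamificationIdx_kOf_dvd_of_triple_{thirty,ten,six,two}` — the fibre-point local-type bounds `e ∣ 30·l`, `∣ 10·l` (`3 ∣ v`),
  `∣ 6·l` (`5 ∣ v`), `∣ 2·l` (`15 ∣ v`) read off the triple;
* §2 **`GenuineK.not_pilotKummerCompatHull_chosen_triple_of_radCerts`** — `a + b = c` coprime, `T` a genuine Θ-volume datum at
  `(ratPoint (a/c), l)`, an odd prime `p ≠ l` with `p^v ∥ abc` (`v ≥ 1`), a label `i₀ + 1 ≤ l⋆`, a local-type bound `m` (`p ∤ m`,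
  `∀ x₀ | p, e(K_{x₀}/ℚ_p) ∣ m` — a BINDER, discharged by §1), and a LIST `certs` of integer quadruples `(e, A, a₀, N)` which COVERS the
  divisors of `m` (`∀ e ∈ Nat.divisors m, ∃ t ∈ certs, t.1 = e`) and is VALID (for every entry: `1 ≤ e`, the `logRadiusA` window
  `(A−1)(p−2) < e ≤ A(p−2)`, the turning point `a₀ = 0 ∨ p^{a₀−1}(p−1) < e`, `e ≤ p^{a₀}(p−1)`, and the two RAD inequalities of p464754 with
  `h = 2v`, `δ = e − 1`) ⇒ the hull-level clause S_H at the genuine sharp setting over `T.K` (CHOSEN realising ideles, PINNED reading —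
  verbatim the per-datum object of `hSHw`/`hSHwBad` p447945/p450130/p453137) FAILS for every choice of the free context binders and Kummer datum.
  Both list conditions are DECIDABLE propositions on literals: a row supplies `certs` (desk search, HOME/staging/w5/w5-d236/g9/radcert.py) and
  closes them by `decide`.

HONEST SCOPE as in the parents: an UPPER BOUND on the hull read at ONE diagonal summand (`j = i₀+1`, any place over `p`); SHARP reading;
per-label licence STRONGER than print; admissibility / Szpiro-badness / (P6) of `(ratPoint (a/c), l)` and non-emptiness of the datum type are
NOT claimed (apex inputs); «refuted as typed» ≠ «refuted in print»; nothing about the number-level Corollary; typed ≠ proved;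
instantiated ≠ endorsed. [cite: Mochizuki2012, IUTchIII Cor. 3.12 Step (xi-f) p. 184; IUTchIV Prop. 1.2 (i)(ii) p. 10, Cor. 2.2 (ii) proof p. 44–46,
Thm. 1.10 Steps (ii)–(iii) p. 24–26] [cite: Serre1972, §1.11–§1.12] [cite: NeukirchANT1999, Ch. II (5.5)] [cite: Oesterle1988, §1]
[claim: Mochizuki2012, status: disputed] for every IUT sentence quoted.
-/

noncomputable section

open Set Function NumberField IsDedekindDomain

namespace Summit.ABC.IUTFork.Conditional

open Thm311 Thm311.Real Cor312 Cor312Vol Cor312Prov Literature.IUT.LogThetaLattice Literature.IUT.LogVolume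
  Literature.IUT.HodgeTheaters Literature.IUT.LogVolume.ThetaData Literature.IUT.LogVolume.Cor22
open Literature.NumberTheory.NumberFields Literature.NumberTheory.GaloisRepresentations.Ultrametric
open Literature.NumberTheory.DiophantineGeometry Literature.NumberTheory.DiophantineGeometry.GenEll Summit.ABC.ABC.Theorems

/-! ## §0. The `15 ∣ ord` fibre-point Tate local type -/

/-- **`15 ∣ ord_p j(λ) ⇒ e(K_{x₀}/ℚ_p) ∣ 2·l` at every fibre point `x₀ | p`** (`p ∉ {2, 3, 5, l}` a pole of `j(λ)`; both the `3`- and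
the `5`-torsion unramified; `ThetaVolumeDatumAt.ramificationIdx_int_dvd_two_mul_ratPoint'`). [cite: Mochizuki2012, IUTchIV Thm. 1.10 proof
Steps (ii)–(iii) p. 24–26] [cite: Serre1972, §1.11–§1.12] [claim: Mochizuki2012, status: disputed] -/
theorem GenuineK.absRamificationIdx_kOf_dvd_two_mul_ratPoint {q : ℚ} {l : ℕ} (T : Cor22.ThetaVolumeDatumAt (ratPoint q) l)
    (pp : Nat.Primes) (hp2 : (pp : ℕ) ≠ 2) (hp3 : (pp : ℕ) ≠ 3) (hp5 : (pp : ℕ) ≠ 5) (hpl : (pp : ℕ) ≠ l)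
    (hpole : ∀ v : HeightOneSpectrum (𝓞 ℚ), Rat.HeightOneSpectrum.natGenerator v = pp →
      Literature.IUT.LogVolume.ord ℚ v (Cor22.jInv q) < 0)
    (hord : ∀ v : HeightOneSpectrum (𝓞 ℚ), Rat.HeightOneSpectrum.natGenerator v = pp →
      (15 : ℤ) ∣ Literature.IUT.LogVolume.ord ℚ v (Cor22.jInv q)) :
    letI := T.instFieldF; letI := T.instNumberFieldF; letI := T.instAlgebraF; letI := T.instFieldK
    letI := T.instNumberFieldK; letI := T.instAlgebraK; letI := T.instFieldFbar; letI := T.instAlgebraFbar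
    letI := T.instAlgebraKFbar; letI := T.instIsElliptic
    haveI : Fact (pp : ℕ).Prime := ⟨pp.2⟩
    ∀ x₀ : (thetaIndex (pilotDataOfK T.D T.K)).Fibre (.inr pp),
      absRamificationIdx (pp : ℕ) (kOf (pilotDataOfK T.D T.K) pp.1 x₀) ∣ 2 * l := by
  letI := T.instFieldF; letI := T.instNumberFieldF; letI := T.instAlgebraF; letI := T.instFieldK
  letI := T.instNumberFieldK; letI := T.instAlgebraK; letI := T.instFieldFbar; letI := T.instAlgebraFbar
  letI := T.instAlgebraKFbar; letI := T.instIsElliptic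
  haveI : Fact (pp : ℕ).Prime := ⟨pp.2⟩
  set X := pilotDataOfK T.D T.K with hXdef
  intro x₀
  set w := placeOf X pp.1 x₀ with hwdef
  have hpw : ((pp : ℕ) : 𝓞 T.K) ∈ w.asIdeal := natCast_mem_placeOf X pp.1 x₀
  have hwchar : residueChar T.K w = (pp : ℕ) := residueChar_eq_of_natCast_mem pp.1 hpw
  have hekOf : absRamificationIdx (pp : ℕ) (kOf X pp.1 x₀) = w.asIdeal.ramificationIdx ℤ := by
    rw [show absRamificationIdx (pp : ℕ) (kOf X pp.1 x₀) =
        absRamificationIdx (pp : ℕ) (RescaledCompletion T.K pp.1 (placeOf X pp.1 x₀) hpw) from rfl,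
      absRamificationIdx_rescaledCompletion]
  have hnot : (pp : ℕ) ∉ ({2, 3, 5, l} : Finset ℕ) := by
    simp only [Finset.mem_insert, Finset.mem_singleton, not_or]
    exact ⟨hp2, hp3, hp5, hpl⟩
  rw [hekOf]
  exact T.ramificationIdx_int_dvd_two_mul_ratPoint' hnot hpole hord w hwchar

/-! ## §1. The integers of an abc-triple datum at a pole prime: exact pole order and the local-type bound -/

/-- **`ord_p j(a/c) = −2v` EXACTLY** for an abc triple `a + b = c` and an odd prime `p` with `p^v ∣ abc`, `p^{v+1} ∤ abc` (`v ≥ 1`):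
`v_p(abc) = v` by `Nat.Prime.pow_dvd_iff_le_factorization`, then abc-iut-W-neg-1's `Cor22.ord_jInv_ratPoint_triple_eq`.
[cite: Mochizuki2012, IUTchIV Cor. 2.2 (ii) proof p. 44] [cite: SilvermanAEC2009, Prop. III.1.7(b)] -/
theorem RadTriple.ord_jInv_eq_of_pow_dvd {a b c : ℕ} (habc : IsABCTriple a b c) {p : ℕ} (hp : p.Prime) (hp2 : p ≠ 2) {v : ℕ}
    (hv : 1 ≤ v) (hdvd : p ^ v ∣ a * b * c) (hndvd : ¬ p ^ (v + 1) ∣ a * b * c)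
    (u : HeightOneSpectrum (𝓞 ℚ)) (hu : Rat.HeightOneSpectrum.natGenerator u = p) :
    Literature.IUT.LogVolume.ord ℚ u (Cor22.jInv ((a : ℚ) / c)) = -((2 * v : ℕ) : ℤ) := by
  have habc0 : a * b * c ≠ 0 := by
    obtain ⟨ha, hb, hsum, -⟩ := habc
    exact Nat.mul_ne_zero (Nat.mul_ne_zero ha.ne' hb.ne') (by omega)
  have hfac : (a * b * c).factorization p = v := by
    have h1 : v ≤ (a * b * c).factorization p := (hp.pow_dvd_iff_le_factorization habc0).1 hdvd
    have h2 : ¬ v + 1 ≤ (a * b * c).factorization p := fun h6 => hndvd ((hp.pow_dvd_iff_le_factorization habc0).2 h6)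
    omega
  have hpabc : p ∣ a * b * c := (dvd_pow_self p (by omega)).trans hdvd
  rw [Cor22.ord_jInv_ratPoint_triple_eq habc u (by rw [hu]; exact hp2) (by rw [hu]; exact hpabc), hu, hfac]
  push_cast
  ring

/-- At every place of `ℚ` over such a `p`, `j(a/c)` has a POLE. [cite: Mochizuki2012, IUTchIV Cor. 2.2 (ii) proof p. 44] -/
theorem RadTriple.ord_jInv_neg_of_pow_dvd {a b c : ℕ} (habc : IsABCTriple a b c) {p : ℕ} (hp : p.Prime) (hp2 : p ≠ 2) {v : ℕ}
    (hv : 1 ≤ v) (hdvd : p ^ v ∣ a * b * c) (hndvd : ¬ p ^ (v + 1) ∣ a * b * c)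
    (u : HeightOneSpectrum (𝓞 ℚ)) (hu : Rat.HeightOneSpectrum.natGenerator u = p) :
    Literature.IUT.LogVolume.ord ℚ u (Cor22.jInv ((a : ℚ) / c)) < 0 := by
  rw [RadTriple.ord_jInv_eq_of_pow_dvd habc hp hp2 hv hdvd hndvd u hu]
  have : (0 : ℤ) < ((2 * v : ℕ) : ℤ) := by exact_mod_cast (show 0 < 2 * v by omega)
  omega

/-- `k ∣ v ⇒ (2k : ℤ) ∣ ord_p j(a/c)` hence `(k' : ℤ) ∣ ord_p j(a/c)` for `k' ∣ 2v` — the divisibility inputs of the Tate-exact lemmas.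
[cite: Mochizuki2012, IUTchIV Cor. 2.2 (ii) proof p. 44] -/
theorem RadTriple.intCast_dvd_ord_jInv_of_dvd {a b c : ℕ} (habc : IsABCTriple a b c) {p : ℕ} (hp : p.Prime) (hp2 : p ≠ 2) {v : ℕ}
    (hv : 1 ≤ v) (hdvd : p ^ v ∣ a * b * c) (hndvd : ¬ p ^ (v + 1) ∣ a * b * c) {k : ℕ} (hk : k ∣ 2 * v)
    (u : HeightOneSpectrum (𝓞 ℚ)) (hu : Rat.HeightOneSpectrum.natGenerator u = p) :
    (k : ℤ) ∣ Literature.IUT.LogVolume.ord ℚ u (Cor22.jInv ((a : ℚ) / c)) := by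
  rw [RadTriple.ord_jInv_eq_of_pow_dvd habc hp hp2 hv hdvd hndvd u hu]
  exact (Int.natCast_dvd_natCast.2 hk).neg_right

section LocalType

variable {a b c : ℕ} (habc : IsABCTriple a b c) {l : ℕ} (T : Cor22.ThetaVolumeDatumAt (ratPoint ((a : ℚ) / c)) l)
  (pp : Nat.Primes) (hp2 : (pp : ℕ) ≠ 2) (hp3 : (pp : ℕ) ≠ 3) (hp5 : (pp : ℕ) ≠ 5) (hpl : (pp : ℕ) ≠ l)
  {v : ℕ} (hv : 1 ≤ v) (hdvd : (pp : ℕ) ^ v ∣ a * b * c) (hndvd : ¬ (pp : ℕ) ^ (v + 1) ∣ a * b * c)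

include habc hp2 hp3 hp5 hpl hv hdvd hndvd in
/-- **Local type `∣ 30·l`** at every fibre point over a pole prime `p ∉ {2, 3, 5, l}` of an abc-triple datum (abc-iut-W-neg-1's
`GenuineK.absRamificationIdx_kOf_dvd_thirty_mul_ratPoint`). [cite: Mochizuki2012, IUTchIV Thm. 1.10 proof Steps (ii)–(iii) p. 24–26]
[claim: Mochizuki2012, status: disputed] -/
theorem GenuineK.absRamificationIdx_kOf_dvd_of_triple_thirty :
    letI := T.instFieldF; letI := T.instNumberFieldF; letI := T.instAlgebraF; letI := T.instFieldK
    letI := T.instNumberFieldK; letI := T.instAlgebraK; letI := T.instFieldFbar; letI := T.instAlgebraFbar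
    letI := T.instAlgebraKFbar; letI := T.instIsElliptic
    haveI : Fact (pp : ℕ).Prime := ⟨pp.2⟩
    ∀ x₀ : (thetaIndex (pilotDataOfK T.D T.K)).Fibre (.inr pp),
      absRamificationIdx (pp : ℕ) (kOf (pilotDataOfK T.D T.K) pp.1 x₀) ∣ 30 * l :=
  fun x₀ => (GenuineK.absRamificationIdx_kOf_dvd_thirty_mul_ratPoint T pp hp2 hp3 hp5 hpl
    (RadTriple.ord_jInv_neg_of_pow_dvd habc pp.2 hp2 hv hdvd hndvd) x₀).1

include habc hp2 hp3 hp5 hpl hv hdvd hndvd in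
/-- **Local type `∣ 10·l` when `3 ∣ v`** (Tate-exact, part 1's `…_ten_mul_ratPoint`). [cite: Serre1972, §1.11–§1.12] [claim: Mochizuki2012, status: disputed] -/
theorem GenuineK.absRamificationIdx_kOf_dvd_of_triple_ten (h3 : 3 ∣ v) :
    letI := T.instFieldF; letI := T.instNumberFieldF; letI := T.instAlgebraF; letI := T.instFieldK
    letI := T.instNumberFieldK; letI := T.instAlgebraK; letI := T.instFieldFbar; letI := T.instAlgebraFbar
    letI := T.instAlgebraKFbar; letI := T.instIsElliptic
    haveI : Fact (pp : ℕ).Prime := ⟨pp.2⟩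
    ∀ x₀ : (thetaIndex (pilotDataOfK T.D T.K)).Fibre (.inr pp),
      absRamificationIdx (pp : ℕ) (kOf (pilotDataOfK T.D T.K) pp.1 x₀) ∣ 10 * l :=
  GenuineK.absRamificationIdx_kOf_dvd_ten_mul_ratPoint T pp hp2 hp3 hp5 hpl
    (RadTriple.ord_jInv_neg_of_pow_dvd habc pp.2 hp2 hv hdvd hndvd)
    (RadTriple.intCast_dvd_ord_jInv_of_dvd habc pp.2 hp2 hv hdvd hndvd (dvd_mul_of_dvd_right h3 2))

include habc hp2 hp3 hp5 hpl hv hdvd hndvd in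
/-- **Local type `∣ 6·l` when `5 ∣ v`** (Tate-exact, part 1's `…_six_mul_ratPoint`). [cite: Serre1972, §1.11–§1.12] [claim: Mochizuki2012, status: disputed] -/
theorem GenuineK.absRamificationIdx_kOf_dvd_of_triple_six (h5 : 5 ∣ v) :
    letI := T.instFieldF; letI := T.instNumberFieldF; letI := T.instAlgebraF; letI := T.instFieldK
    letI := T.instNumberFieldK; letI := T.instAlgebraK; letI := T.instFieldFbar; letI := T.instAlgebraFbar
    letI := T.instAlgebraKFbar; letI := T.instIsElliptic
    haveI : Fact (pp : ℕ).Prime := ⟨pp.2⟩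
    ∀ x₀ : (thetaIndex (pilotDataOfK T.D T.K)).Fibre (.inr pp),
      absRamificationIdx (pp : ℕ) (kOf (pilotDataOfK T.D T.K) pp.1 x₀) ∣ 6 * l :=
  GenuineK.absRamificationIdx_kOf_dvd_six_mul_ratPoint T pp hp2 hp3 hp5 hpl
    (RadTriple.ord_jInv_neg_of_pow_dvd habc pp.2 hp2 hv hdvd hndvd)
    (RadTriple.intCast_dvd_ord_jInv_of_dvd habc pp.2 hp2 hv hdvd hndvd (dvd_mul_of_dvd_right h5 2))

include habc hp2 hp3 hp5 hpl hv hdvd hndvd in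
/-- **Local type `∣ 2·l` when `15 ∣ v`** (Tate-exact, §0). [cite: Serre1972, §1.11–§1.12] [claim: Mochizuki2012, status: disputed] -/
theorem GenuineK.absRamificationIdx_kOf_dvd_of_triple_two (h15 : 15 ∣ v) :
    letI := T.instFieldF; letI := T.instNumberFieldF; letI := T.instAlgebraF; letI := T.instFieldK
    letI := T.instNumberFieldK; letI := T.instAlgebraK; letI := T.instFieldFbar; letI := T.instAlgebraFbar
    letI := T.instAlgebraKFbar; letI := T.instIsElliptic
    haveI : Fact (pp : ℕ).Prime := ⟨pp.2⟩
    ∀ x₀ : (thetaIndex (pilotDataOfK T.D T.K)).Fibre (.inr pp),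
      absRamificationIdx (pp : ℕ) (kOf (pilotDataOfK T.D T.K) pp.1 x₀) ∣ 2 * l :=
  GenuineK.absRamificationIdx_kOf_dvd_two_mul_ratPoint T pp hp2 hp3 hp5 hpl
    (RadTriple.ord_jInv_neg_of_pow_dvd habc pp.2 hp2 hv hdvd hndvd)
    (RadTriple.intCast_dvd_ord_jInv_of_dvd habc pp.2 hp2 hv hdvd hndvd (dvd_mul_of_dvd_right h15 2))

end LocalType

/-! ## §2. The certificate-list refutation -/

/-- **RAD REFUTATION AT AN abc-TRIPLE DATUM, CERTIFICATE-LIST FORM.** `a + b = c` coprime, `T` a genuine Θ-volume datum at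
`(ratPoint (a/c), l)`; an odd prime `p ≠ l` with `p^v ∣ abc`, `p^{v+1} ∤ abc` (`v ≥ 1`; pole order `h = 2v`); a label `j = i₀+1 ≤ l⋆`;
a local-type bound `m` with `p ∤ m` and `e(K_{x₀}/ℚ_p) ∣ m` at every fibre point `x₀ | p` (binder; §1 discharges it from the triple); a
list `certs` of quadruples `(e, A, a₀, N)` COVERING `Nat.divisors m` and VALID (window of `A`, turning point `a₀`, and the two RAD
inequalities of p464754 with `h = 2v`, `δ = e − 1`). THEN the hull-level clause S_H at the genuine sharp setting over `T.K` (CHOSEN realising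
ideles, PINNED reading) FAILS for every choice of the free context binders and Kummer datum — one `exact …_of_not_dvd` at the certificate of
the realised local type of any place over `p`. Both list conditions are decidable; rows close them by `decide`.
[cite: Mochizuki2012, IUTchIII Cor. 3.12 Step (xi-f) p. 184; IUTchIV Prop. 1.2 (i)(ii) p. 10] [cite: NeukirchANT1999, Ch. II (5.5)]
[claim: Mochizuki2012, status: disputed] -/
theorem GenuineK.not_pilotKummerCompatHull_chosen_triple_of_radCerts {a b c : ℕ} (habc : IsABCTriple a b c) {l : ℕ}
    (T : Cor22.ThetaVolumeDatumAt (ratPoint ((a : ℚ) / c)) l) (pp : Nat.Primes) (hp2 : (pp : ℕ) ≠ 2) (hpl : (pp : ℕ) ≠ l)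
    (v : ℕ) (hv : 1 ≤ v) (hdvd : (pp : ℕ) ^ v ∣ a * b * c) (hndvd : ¬ (pp : ℕ) ^ (v + 1) ∣ a * b * c)
    (i₀ : ℕ) (hil : i₀ + 1 ≤ (l - 1) / 2) (m : ℕ) (hpm : ¬ (pp : ℕ) ∣ m)
    (hloc : letI := T.instFieldF; letI := T.instNumberFieldF; letI := T.instAlgebraF; letI := T.instFieldK
      letI := T.instNumberFieldK; letI := T.instAlgebraK; letI := T.instFieldFbar; letI := T.instAlgebraFbar
      letI := T.instAlgebraKFbar; letI := T.instIsElliptic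
      haveI : Fact (pp : ℕ).Prime := ⟨pp.2⟩
      ∀ x₀ : (thetaIndex (pilotDataOfK T.D T.K)).Fibre (.inr pp), absRamificationIdx (pp : ℕ) (kOf (pilotDataOfK T.D T.K) pp.1 x₀) ∣ m)
    (certs : List (ℕ × ℕ × ℕ × ℤ))
    (hcover : ∀ e ∈ Nat.divisors m, ∃ t ∈ certs, t.1 = e)
    (hvalid : ∀ t ∈ certs, 1 ≤ t.1 ∧ (t.2.1 - 1) * ((pp : ℕ) - 2) < t.1 ∧ t.1 ≤ t.2.1 * ((pp : ℕ) - 2) ∧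
      (t.2.2.1 = 0 ∨ ((pp : ℕ) : ℤ) ^ (t.2.2.1 - 1) * (((pp : ℕ) : ℤ) - 1) < t.1) ∧
      (t.1 : ℤ) ≤ ((pp : ℕ) : ℤ) ^ t.2.2.1 * (((pp : ℕ) : ℤ) - 1) ∧
      2 * (l : ℤ) * t.1 * t.2.2.2 ≤
        ((i₀ : ℤ) + 1) ^ 2 * ((2 * v : ℕ) : ℤ) * t.1 - 2 * l * (((i₀ : ℤ) + 1) * ((t.1 : ℤ) - 1) + ((i₀ : ℤ) + 2) * t.2.1) ∧
      (((2 * v : ℕ) : ℤ)) * t.1 < 2 * l * ((t.1 : ℤ) * t.2.2.2 + ((i₀ : ℤ) + 2) * (((pp : ℕ) : ℤ) ^ t.2.2.1 - t.1 * t.2.2.1))) :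
    letI := T.instFieldF; letI := T.instNumberFieldF; letI := T.instAlgebraF; letI := T.instFieldK
    letI := T.instNumberFieldK; letI := T.instAlgebraK; letI := T.instFieldFbar; letI := T.instAlgebraFbar
    letI := T.instAlgebraKFbar; letI := T.instIsElliptic
    ∀ (M : Type) [Field M] [NumberField M]
      (archPk : ∀ (j : (thetaIndex (pilotDataOfK T.D T.K)).Label) (vQ : (thetaIndex (pilotDataOfK T.D T.K)).VQ),
        Set ((logShellsDH (pilotDataOfK T.D T.K) (analyticLogv T.K)).Packet j vQ))
      (archSub : ∀ (j : (thetaIndex (pilotDataOfK T.D T.K)).Label) (v : (thetaIndex (pilotDataOfK T.D T.K)).V),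
        Set ((logShellsDH (pilotDataOfK T.D T.K) (analyticLogv T.K)).Packet j ((thetaIndex (pilotDataOfK T.D T.K)).over v)))
      (Ψ : ℤ → ∀ v : (thetaIndex (pilotDataOfK T.D T.K)).V, v ∈ (thetaIndex (pilotDataOfK T.D T.K)).Vbad →
        Set ((logShellsDH (pilotDataOfK T.D T.K) (analyticLogv T.K)).StarPacket v))
      (act : ℤ → ∀ v : (thetaIndex (pilotDataOfK T.D T.K)).V, v ∈ (thetaIndex (pilotDataOfK T.D T.K)).Vbad →
        (logShellsDH (pilotDataOfK T.D T.K) (analyticLogv T.K)).StarPacket v →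
          Module.End ℚ ((logShellsDH (pilotDataOfK T.D T.K) (analyticLogv T.K)).StarPacket v))
      (Mmod : ℤ → ∀ j : (thetaIndex (pilotDataOfK T.D T.K)).LabelStar, Set ((logShellsDH (pilotDataOfK T.D T.K) (analyticLogv T.K)).GlobalPacket j.1))
      (region : ℤ → ∀ j : (thetaIndex (pilotDataOfK T.D T.K)).LabelStar, FinDivisor M → ∀ vQ : (thetaIndex (pilotDataOfK T.D T.K)).VQ,
        Set ((logShellsDH (pilotDataOfK T.D T.K) (analyticLogv T.K)).Packet j.1 vQ))
      (frobAdm : ℤ → ℤ → ∀ (j : (thetaIndex (pilotDataOfK T.D T.K)).Label) (vQ : (thetaIndex (pilotDataOfK T.D T.K)).VQ),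
        Set ((logShellsDH (pilotDataOfK T.D T.K) (analyticLogv T.K)).Packet j vQ) → Prop)
      (frobLogvol : ℤ → ℤ → ∀ (j : (thetaIndex (pilotDataOfK T.D T.K)).Label) (vQ : (thetaIndex (pilotDataOfK T.D T.K)).VQ),
        Set ((logShellsDH (pilotDataOfK T.D T.K) (analyticLogv T.K)).Packet j vQ) → ℝ)
      (frobΨ : ℤ → ℤ → ∀ v : (thetaIndex (pilotDataOfK T.D T.K)).V, v ∈ (thetaIndex (pilotDataOfK T.D T.K)).Vbad →
        Set ((logShellsDH (pilotDataOfK T.D T.K) (analyticLogv T.K)).StarPacket v))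
      (frobMmod : ℤ → ℤ → ∀ j : (thetaIndex (pilotDataOfK T.D T.K)).LabelStar, Set ((logShellsDH (pilotDataOfK T.D T.K) (analyticLogv T.K)).GlobalPacket j.1))
      (unitImage : ℤ → ℤ → ℕ → ∀ (j : (thetaIndex (pilotDataOfK T.D T.K)).Label) (vQ : (thetaIndex (pilotDataOfK T.D T.K)).VQ),
        Set ((logShellsDH (pilotDataOfK T.D T.K) (analyticLogv T.K)).Packet j vQ))
      (ballImage : ℤ → ℤ → ∀ (j : (thetaIndex (pilotDataOfK T.D T.K)).Label) (vQ : (thetaIndex (pilotDataOfK T.D T.K)).VQ),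
        Set ((logShellsDH (pilotDataOfK T.D T.K) (analyticLogv T.K)).Packet j vQ))
      (thetaDiv : ℤ → ℤ → LgpDivisor M (thetaIndex (pilotDataOfK T.D T.K)).lstar)
      (n : ℤ) {HT : Type} {LogLink : HT → HT → Type} {IsFull : ∀ {s t : HT}, LogLink s t → Prop}
      (lat : LGPGaussianLogThetaLattice LogLink IsFull)
      {Frd : Type} {IsoF : Frd → Frd → Type} {Ob : Frd → Type} {realify : Frd → Frd} {Strip : Type}
      {IsoS : Strip → Strip → Type} {Mv : ∀ v : (thetaIndex (pilotDataOfK T.D T.K)).V, v ∈ (thetaIndex (pilotDataOfK T.D T.K)).Vbad → Type}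
      [∀ v h, Monoid (Mv v h)]
      (sig : GlobalLGPFrobenioidSignature (thetaIndex (pilotDataOfK T.D T.K)).lstar (thetaIndex (pilotDataOfK T.D T.K)).V
        (· ∈ (thetaIndex (pilotDataOfK T.D T.K)).Vbad) Frd IsoF Ob realify Strip IsoS Mv)
      (split : SplittingMonoids Mv) {ObΔ : Type} {N : ∀ v : (thetaIndex (pilotDataOfK T.D T.K)).V, v ∈ (thetaIndex (pilotDataOfK T.D T.K)).Vbad → Type}
      [∀ v h, Monoid (N v h)] (qData : QPilotData ObΔ N)
      (qK : ∀ v : (thetaIndex (pilotDataOfK T.D T.K)).V, v ∈ (thetaIndex (pilotDataOfK T.D T.K)).Vbad →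
        Set ((logShellsDH (pilotDataOfK T.D T.K) (analyticLogv T.K)).StarPacket v)),
      ¬ Cor312Vol.PilotKummerCompatHull
          (LatticeSituation.ofShells (logShellsDH (pilotDataOfK T.D T.K) (analyticLogv T.K)) M archPk archSub
            (summandPiecesPr (pilotDataOfK T.D T.K) (logvAnalytic_analyticLogv (F := T.K))).Adm
            (summandPiecesPr (pilotDataOfK T.D T.K) (logvAnalytic_analyticLogv (F := T.K))).logvol Ψ act Mmod region frobAdm frobLogvol frobΨ
            frobMmod unitImage ballImage thetaDiv)
          (settingPrVolSharp (pilotDataOfK T.D T.K) (logvAnalytic_analyticLogv (F := T.K)) M archPk archSub Ψ act Mmod region n lat sig split qData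
            (exists_realising_qIdeles_pilotDataOfK T.D).choose (exists_realising_thetaIdeles_pilotDataOfK T.D).choose
            (exists_realising_qIdeles_pilotDataOfK T.D).choose_spec.1 (exists_realising_qIdeles_pilotDataOfK T.D).choose_spec.2.1)
          (fun _ => Cor312.Setting.qRegion
            (settingPrVolSharp (pilotDataOfK T.D T.K) (logvAnalytic_analyticLogv (F := T.K)) M archPk archSub Ψ act Mmod region n lat sig split qData
              (exists_realising_qIdeles_pilotDataOfK T.D).choose (exists_realising_thetaIdeles_pilotDataOfK T.D).choose
              (exists_realising_qIdeles_pilotDataOfK T.D).choose_spec.1 (exists_realising_qIdeles_pilotDataOfK T.D).choose_spec.2.1)) qK := by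
  classical
  letI := T.instFieldF; letI := T.instNumberFieldF; letI := T.instAlgebraF; letI := T.instFieldK
  letI := T.instNumberFieldK; letI := T.instAlgebraK; letI := T.instFieldFbar; letI := T.instAlgebraFbar
  letI := T.instAlgebraKFbar; letI := T.instIsElliptic
  haveI : Fact (pp : ℕ).Prime := ⟨pp.2⟩
  intro M _ _ archPk archSub Ψ act Mmod region frobAdm frobLogvol frobΨ frobMmod unitImage ballImage thetaDiv n HT LogLink IsFull lat
    Frd IsoF Ob realify Strip IsoS Mv _ sig split ObΔ N _ qData qK
  -- a place over `p`, its local type `e₀ ∣ m`, and the certificate of `e₀`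
  obtain ⟨x, hx⟩ := (thetaIndex (pilotDataOfK T.D T.K)).fibre_nonempty (.inr pp)
  have hm0 : m ≠ 0 := by rintro rfl; exact hpm (dvd_zero _)
  obtain ⟨t, ht, hte⟩ := hcover _ (Nat.mem_divisors.2 ⟨hloc ⟨x, hx⟩, hm0⟩)
  obtain ⟨he, hAlo, hAhi, ha₀lo, ha₀hi, hN1, hN2⟩ := hvalid t ht
  have hpe : ¬ (pp : ℕ) ∣ t.1 := fun h => hpm (h.trans (hte ▸ hloc ⟨x, hx⟩))
  have hord : ∀ u : HeightOneSpectrum (𝓞 ℚ), Rat.HeightOneSpectrum.natGenerator u = (pp : ℕ) →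
      Literature.IUT.LogVolume.ord ℚ u (Cor22.jInv ((a : ℚ) / c)) = -((2 * v : ℕ) : ℤ) :=
    fun u hu => RadTriple.ord_jInv_eq_of_pow_dvd habc pp.2 hp2 hv hdvd hndvd u hu
  exact GenuineK.not_pilotKummerCompatHull_chosen_ratPoint_of_star_envelope_of_not_dvd T pp hp2 hpl (2 * v) (by omega) hord i₀ hil
    t.1 t.2.1 t.2.2.1 t.2.2.2 he hpe hAlo hAhi ha₀lo ha₀hi hN1 hN2 ⟨x, hx⟩ hte.symm M archPk archSub Ψ act Mmod region frobAdm
    frobLogvol frobΨ frobMmod unitImage ballImage thetaDiv n lat sig split qData qK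

end Summit.ABC.IUTFork.Conditional

end
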